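import Summits.Ventures.DiscreteObjects.Hadamard.ConferenceGraph333Order22RankTest

/-!
# Order `44` in Aut(srg(333,166,82,83)): the rank test for `σ` against `ρ = σ⁴` (kernel)

Framing: lottery ticket; floor = certified bounds/negative ranges.  Cell pub-namedobj (venture DiscreteObjects),
target (H) = `H(668)`, hadamard gen 31.  Second corollary of the kernel rank test (`ConferenceGraph333Order11RankTest`): for `σ` of order `44`,
`ρ = σ⁴` has order `11`, and a `ρ`-moved vertex `x` has `σx ∈ ⟨ρ⟩x` iff `σ¹¹x = x` (then `σx = σ¹²x = ρ³x`; conversely `σx = ρᵏx` gives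
`σ¹¹x = σ⁴⁴ᵏx = x`), so the number of `σ`-invariant `ρ`-orbits is `t = (#Fix σ¹¹ − #Fix σ)/11` while `f_F = #Fix σ`:
* **`aut_order44_rank`** — `11 ∣ #Fix σ¹¹ − #Fix σ` and `|#Fix σ¹¹ − 12·#Fix σ| ≤ 33` (i.e. `(t − f_F)² ≤ 9`), and `#Fix σ⁴ = 25`.
Together with `aut_order22_census` applied to `σ²` (order `22`) this realises, in the kernel, the trace-bound part of the E2 character test
(pub-namedobj-hadamard-g31/results/rank_test_11_g31.txt: order `44`, twelve kit types → five).  WORDS: structure of a HYPOTHETICAL object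
(order `44` remains admissible); ours (PROVISIONAL).  No `sorry`, no new definitions.
-/

namespace Summit.Ventures.DiscreteObjects.Hadamard

open Finset

section order44
variable {V : Type*} [Fintype V] [DecidableEq V]

/-- **Order `44`: the rank test against `ρ = σ⁴`** — `#Fix σ⁴ = 25`, `11 ∣ #Fix σ¹¹ − #Fix σ`, `|#Fix σ¹¹ − 12 #Fix σ| ≤ 33`. -/
theorem aut_order44_rank (hV : Fintype.card V = 333) (A : Matrix V V ℤ)
    (h01 : ∀ x y, A x y = 0 ∨ A x y = 1) (hsymm : ∀ x y, A y x = A x y) (hdiag : ∀ x, A x x = 0)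
    (hk : ∀ x, ∑ y, A x y = 166) (hsrg : ∀ x y, ∑ z, A x z * A z y = 83 * (1 + (if x = y then 1 else 0)) - A x y)
    (σ : Equiv.Perm V) (hσ : σ ^ 44 = 1) (hσ4 : σ ^ 4 ≠ 1) (hA : ∀ x y, A (σ x) (σ y) = A x y) :
    (univ.filter fun x => (σ ^ 4) x = x).card = 25 ∧
    (∃ t : ℕ, (univ.filter fun x => (σ ^ 11) x = x).card = (univ.filter fun x => σ x = x).card + 11 * t ∧
      ((t : ℤ) - (univ.filter fun x => σ x = x).card) ^ 2 ≤ 9) := by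
  have hAk := adj_pow_invariant A σ hA
  have hρ : (σ ^ 4) ^ 11 = 1 := by rw [← pow_mul]; exact hσ
  have hcomm : σ * σ ^ 4 = σ ^ 4 * σ := by rw [← pow_succ', ← pow_succ]
  have hpowk : ∀ (m k : ℕ) x, (σ ^ m) (((σ ^ 4) ^ k) x) = ((σ ^ 4) ^ k) ((σ ^ m) x) := fun m k x => by
    rw [← Equiv.Perm.mul_apply, ← Equiv.Perm.mul_apply, ← pow_mul, ← pow_add, ← pow_add, add_comm]
  -- the rank test for σ against ρ = σ⁴
  obtain ⟨t, ht11, hineq⟩ := aut_order11_commuting_rank_test hV A h01 hsymm hdiag hk hsrg (σ ^ 4) hρ hσ4 (hAk 4) σ hcomm hA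
  -- Fix σ ∩ Fix ρ = Fix σ
  have hfix : (univ.filter fun x => σ x = x ∧ (σ ^ 4) x = x) = univ.filter fun x => σ x = x := by
    refine Finset.filter_congr fun x _ => ⟨fun h => h.1, fun h => ⟨h, Equiv.Perm.pow_apply_eq_self_of_apply_eq_self h 4⟩⟩
  rw [hfix] at hineq
  -- a ρ-moved x with σx ∈ ⟨ρ⟩x is σ¹¹-fixed, and conversely
  have hkey : ∀ x, (σ ^ 4) x ≠ x →
      (σ x ∈ (Finset.range 11).image (fun k => ((σ ^ 4) ^ k) x) ↔ (σ ^ 11) x = x) := by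
    intro x hx
    constructor
    · intro hmem
      obtain ⟨k, -, hkx⟩ := Finset.mem_image.mp hmem
      -- σ^m x = (σ^4)^(k m) x for all m, by induction
      have hind : ∀ m : ℕ, (σ ^ m) x = ((σ ^ 4) ^ (k * m)) x := by
        intro m
        induction m with
        | zero => simp
        | succ m ih =>
          rw [pow_succ', Equiv.Perm.mul_apply, ih]
          have e1 : σ (((σ ^ 4) ^ (k * m)) x) = ((σ ^ 4) ^ (k * m)) (σ x) := by
            have := hpowk 1 (k * m) x; rwa [pow_one] at this
          rw [e1, ← hkx, ← Equiv.Perm.mul_apply, ← pow_add, show k * m + k = k * (m + 1) by ring]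
      have h11 := hind 11
      rw [← pow_mul, show 4 * (k * 11) = 44 * k by ring, pow_mul, hσ, one_pow, Equiv.Perm.one_apply] at h11
      exact h11
    · intro h
      refine Finset.mem_image.mpr ⟨3, Finset.mem_range.mpr (by norm_num), ?_⟩
      -- ρ³ x = σ¹² x = σ (σ¹¹ x) = σ x
      show ((σ ^ 4) ^ 3) x = σ x
      rw [← pow_mul, show (4 * 3 : ℕ) = 1 + 11 by norm_num, pow_add, pow_one, Equiv.Perm.mul_apply, h]
  have hset : (univ.filter fun x => (σ ^ 4) x ≠ x ∧ σ x ∈ (Finset.range 11).image (fun k => ((σ ^ 4) ^ k) x)) =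
      univ.filter fun x => (σ ^ 11) x = x ∧ ¬ (σ ^ 4) x = x := by
    refine Finset.filter_congr fun x _ => ⟨fun ⟨hx, hm⟩ => ⟨(hkey x hx).mp hm, hx⟩, fun ⟨h, hx⟩ => ⟨hx, (hkey x hx).mpr h⟩⟩
  have hX : (univ.filter fun x => (σ ^ 11) x = x ∧ ¬ (σ ^ 4) x = x).card = 11 * t := by rw [← hset]; exact ht11
  -- Fix σ¹¹ ∩ Fix σ⁴ = Fix σ
  have hfix2 : (univ.filter fun x => (σ ^ 11) x = x ∧ (σ ^ 4) x = x) = univ.filter fun x => σ x = x := by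
    refine Finset.filter_congr fun x _ => ⟨fun ⟨h11, h4⟩ => ?_, fun h => ⟨?_, ?_⟩⟩
    · have h12 : (σ ^ 12) x = x := by
        rw [show (12 : ℕ) = 4 * 3 by norm_num, pow_mul]
        exact Equiv.Perm.pow_apply_eq_self_of_apply_eq_self h4 3
      rw [pow_succ', Equiv.Perm.mul_apply, h11] at h12
      exact h12
    · exact Equiv.Perm.pow_apply_eq_self_of_apply_eq_self h 11
    · exact Equiv.Perm.pow_apply_eq_self_of_apply_eq_self h 4
  have hsplit := Finset.card_filter_add_card_filter_not (s := univ.filter fun x => (σ ^ 11) x = x) (fun x => (σ ^ 4) x = x)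
  rw [Finset.filter_filter, Finset.filter_filter, hfix2, hX] at hsplit
  have w4 := aut_order11_fixed hV A h01 hsymm hdiag hk hsrg (σ ^ 4) hρ hσ4 (hAk 4)
  exact ⟨w4, t, hsplit.symm, hineq⟩

end order44

end Summit.Ventures.DiscreteObjects.Hadamard
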